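import Summits.QuantumFields.YangMills.Theorems.NPointIsotropy.Negative.TieLoadBearing
import Literature.MathematicalPhysics.QuantumFieldTheory.OSReconstructionNoE1
import HarnessLib

/-!
# `PencilRigidity.NPointIsotropy`, calibration of Σ on the vacuum row: the analytic core
(support for crux stmt-QuantumFields-11686, line `complex-rotation-bandlimit`, generation 12; helper file of the registered stub
`stub_sandwichVacuumRowOfKernel`, which is landed in `PencilRigidityNPointIsotropySandwichVacuumRowOfKernel.lean`)

Model-blind real analysis on `ℝ⁴ ≅ ℝ² × ℝ²` (planar coordinates `(x⁰, x¹)`, transverse coordinates `(x², x³)`), stated over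
`E4 = EuclideanSpace ℝ (Fin 4)` with extended-real (`∫⁻`) integrals, so that no integrability bookkeeping is needed:

* `exists_planarTransverseSplit`, `lintegral_planar_mul_transverse` — Lebesgue measure on `ℝ⁴` is the product of the planar and
  the transverse Lebesgue measures (`WithLp.ofLp`, `finSumFinEquiv`, `sumPiEquivProdPi`, `finTwoArrow` are all measure preserving),
  hence `∫ φ(x⁰,x¹) χ(x²,x³) dx = (∫ φ)(∫ χ)` (Tonelli);
* `lintegral_bracket_lt_top`, `lintegral_transverse_weight_le` — the Japanese bracket `(1 + |w|²)^{-(10-η)/2}` is integrable on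
  `ℝ²` for `η ≤ 2`, and by the scaling `w = 2u·w'`:
  `∫_{ℝ²} (4u² + |w|²)^{-(10-η)/2} dw = (2u)^{η-8} ∫_{ℝ²} (1 + |w|²)^{-(10-η)/2} dw ≤ u^{η-8} ∫_{ℝ²} (1 + |w|²)^{-(10-η)/2} dw`;
* `kernel_pointwise` — for `x₀⁰ ≤ -u`, `x₁⁰ ≥ u` the points are `2u`-separated in time, so a kernel with
  `|K x| ≤ C (1 + |x|^{η-10})` off `0` satisfies `|K(x₀ - x₁)| ≤ C⁺ (1 + (4u² + |x₀⊥ - x₁⊥|²)^{-(10-η)/2})`, `C⁺ = max C 0`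
  (drop the `x¹`-contribution to `|x₀ - x₁|²`; the exponent is negative);
* `double_lintegral_bound` — for a factorised one-point insertion `ψ(x) = g(x⁰,x¹) hh(x²,x³)` with the times of `g` in `[u, 2u]`,
  `∫|g| ≤ Mg`, `∫|hh| ≤ Mh`, `|hh| ≤ Mh'`, and any `L ≥ ∫_{ℝ²} (1 + |w|²)^{-(10-η)/2}`:
  `∫∫ |K(x₀ - x₁)| |ψ(θx₀)| |ψ(x₁)| dx₀ dx₁ ≤ C⁺ (Mg Mh) (Mg (Mh + u^{η-8} L Mh'))` — integrate `x₁⊥` first (`∫|hh| ≤ Mh` against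
  the `1`, `|hh| ≤ Mh'` against the weight, whose integral is translation invariant and scales as above), then `(x₁⁰, x₁¹)`
  (`∫|g| ≤ Mg`), then `x₀` (`θ` preserves Lebesgue measure, `∫|ψ| = ∫|g| ∫|hh| ≤ Mg Mh`).

References: E. M. Stein, Singular Integrals and Differentiability Properties of Functions (1970), Ch. V §1 (Bessel/Japanese
bracket kernels); J. Glimm, A. Jaffe, Quantum Physics (1987) §6.1, §19.5 (OS sandwich estimates). [folklore]
-/

noncomputable section

namespace Summit.QuantumFields.YangMills.Theorems.NPointIsotropy.ComplexRotationBandlimit.SandwichVacuumRow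

open scoped ENNReal
open MeasureTheory
open Literature.MathematicalPhysics.QuantumLattice Literature.MathematicalPhysics.QuantumFieldTheory
open Summit.QuantumFields.YangMills.Theorems.NPointIsotropy.Negative (E4)

/-! ### Planar/transverse splitting of Lebesgue measure on `ℝ⁴` -/

/-- **`ℝ⁴ ≅ ℝ² × ℝ²` as measure spaces**: the coordinate splitting `x ↦ ((x⁰, x¹), (x², x³))` is a measurable equivalence
preserving Lebesgue measure. [folklore] -/
theorem exists_planarTransverseSplit :
    ∃ e : E4 ≃ᵐ (ℝ × ℝ) × (ℝ × ℝ), MeasurePreserving e volume volume ∧ ∀ x : E4, e x = ((x 0, x 1), (x 2, x 3)) := by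
  refine ⟨((MeasurableEquiv.toLp 2 (Fin 4 → ℝ)).symm.trans
    ((MeasurableEquiv.piCongrLeft (fun _ : Fin 4 => ℝ) (finSumFinEquiv : Fin 2 ⊕ Fin 2 ≃ Fin 4)).symm.trans
      (MeasurableEquiv.sumPiEquivProdPi (fun _ : Fin 2 ⊕ Fin 2 => ℝ)))).trans
    (MeasurableEquiv.prodCongr MeasurableEquiv.finTwoArrow MeasurableEquiv.finTwoArrow), ?_, fun x => rfl⟩
  have h1 : MeasurePreserving (MeasurableEquiv.toLp 2 (Fin 4 → ℝ)).symm volume volume :=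
    EuclideanSpace.volume_preserving_symm_measurableEquiv_toLp (Fin 4)
  have h2 : MeasurePreserving
      (MeasurableEquiv.piCongrLeft (fun _ : Fin 4 => ℝ) (finSumFinEquiv : Fin 2 ⊕ Fin 2 ≃ Fin 4)).symm
      volume volume :=
    (volume_measurePreserving_piCongrLeft (fun _ : Fin 4 => ℝ) _).symm
  have h3 : MeasurePreserving (MeasurableEquiv.sumPiEquivProdPi (fun _ : Fin 2 ⊕ Fin 2 => ℝ)) volume volume :=
    volume_measurePreserving_sumPiEquivProdPi _
  have h4 : MeasurePreserving (MeasurableEquiv.prodCongr MeasurableEquiv.finTwoArrow MeasurableEquiv.finTwoArrow)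
      (volume : Measure ((Fin 2 → ℝ) × (Fin 2 → ℝ))) (volume : Measure ((ℝ × ℝ) × (ℝ × ℝ))) :=
    (volume_preserving_finTwoArrow ℝ).prod (volume_preserving_finTwoArrow ℝ)
  exact (h1.trans (h2.trans h3)).trans h4

/-- **Tonelli across the planar/transverse splitting**: `∫_{ℝ⁴} φ(x⁰,x¹) χ(x²,x³) dx = (∫_{ℝ²} φ)(∫_{ℝ²} χ)` for a.e.-measurable
`φ, χ ≥ 0`. [folklore] -/
theorem lintegral_planar_mul_transverse (φ χ : ℝ × ℝ → ℝ≥0∞) (hφ : AEMeasurable φ) (hχ : AEMeasurable χ) :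
    ∫⁻ x : E4, φ (x 0, x 1) * χ (x 2, x 3) = (∫⁻ p, φ p) * ∫⁻ q, χ q := by
  obtain ⟨e, he, hex⟩ := exists_planarTransverseSplit
  rw [← lintegral_prod_mul hφ hχ]
  refine (lintegral_congr fun x => ?_).trans (he.lintegral_comp_emb e.measurableEmbedding fun z => φ z.1 * χ z.2)
  rw [hex]

/-- The transverse coordinate map `x ↦ (x², x³)` is continuous. [folklore] -/
theorem continuous_transverse : Continuous fun q : E4 => ((q 2, q 3) : ℝ × ℝ) :=
  (EuclideanSpace.proj (2 : Fin 4)).continuous.prodMk (EuclideanSpace.proj (3 : Fin 4)).continuous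

/-! ### The transverse weight `(4u² + |w|²)^{-(10-η)/2}` on `ℝ²` -/

/-- Continuity of `w ↦ (A + |w|²)^s` on `ℝ²` for `A > 0`. [folklore] -/
theorem continuous_bracket_rpow (A s : ℝ) (hA : 0 < A) : Continuous fun w : ℝ × ℝ => (A + ‖w‖ ^ 2) ^ s := by
  refine Continuous.rpow_const (by fun_prop) fun w => Or.inl (ne_of_gt ?_)
  have : 0 ≤ ‖w‖ ^ 2 := sq_nonneg _
  linarith

/-- **The Japanese bracket is integrable on `ℝ²`**: `∫_{ℝ²} (1 + |w|²)^{-(10-η)/2} dw < ∞` for `η ≤ 2` (exponent `10 - η > 2 =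
dim`). [folklore] -/
theorem lintegral_bracket_lt_top (η : ℝ) (hη2 : η ≤ 2) :
    ∫⁻ w : ℝ × ℝ, ENNReal.ofReal ((1 + ‖w‖ ^ 2) ^ (-(10 - η) / 2)) < ∞ := by
  have hr : (Module.finrank ℝ (ℝ × ℝ) : ℝ) < 10 - η := by
    simp only [Module.finrank_prod, Module.finrank_self]
    push_cast
    linarith
  have hint := (integrable_rpow_neg_one_add_norm_sq (μ := (volume : Measure (ℝ × ℝ))) hr).hasFiniteIntegral
  rw [hasFiniteIntegral_iff_enorm] at hint
  refine lt_of_le_of_lt (le_of_eq (lintegral_congr fun w => ?_)) hint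
  rw [Real.enorm_eq_ofReal (by positivity)]

/-- **Scaling of the transverse weight**: `∫_{ℝ²} (4u² + |w|²)^{-(10-η)/2} dw ≤ u^{η-8} ∫_{ℝ²} (1 + |w|²)^{-(10-η)/2} dw` for
`u > 0`, `η ≤ 2` (substitute `w = 2u·w'`: the left side is `(2u)^{η-8}` times the bracket integral, and `2^{η-8} ≤ 1`). [folklore] -/
theorem lintegral_transverse_weight_le (η u : ℝ) (hη2 : η ≤ 2) (hu : 0 < u) :
    ∫⁻ w : ℝ × ℝ, ENNReal.ofReal ((4 * u ^ 2 + ‖w‖ ^ 2) ^ (-(10 - η) / 2)) ≤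
      ENNReal.ofReal (u ^ (η - 8)) * ∫⁻ w : ℝ × ℝ, ENNReal.ofReal ((1 + ‖w‖ ^ 2) ^ (-(10 - η) / 2)) := by
  have h2u : (0 : ℝ) < 2 * u := by positivity
  have h4u : (0 : ℝ) < 4 * u ^ 2 := by positivity
  have hρ'm : Measurable fun y : ℝ × ℝ => ENNReal.ofReal ((4 * u ^ 2 + ‖(2 * u) • y‖ ^ 2) ^ (-(10 - η) / 2)) :=
    (ENNReal.measurable_ofReal.comp (continuous_bracket_rpow _ _ h4u).measurable).comp (measurable_const_smul _)
  have hρ'eq : ∀ y : ℝ × ℝ, ENNReal.ofReal ((4 * u ^ 2 + ‖(2 * u) • y‖ ^ 2) ^ (-(10 - η) / 2)) =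
      ENNReal.ofReal ((4 * u ^ 2) ^ (-(10 - η) / 2)) * ENNReal.ofReal ((1 + ‖y‖ ^ 2) ^ (-(10 - η) / 2)) := by
    intro y
    rw [← ENNReal.ofReal_mul (Real.rpow_nonneg h4u.le _), ← Real.mul_rpow h4u.le (by positivity)]
    congr 2
    rw [norm_smul, Real.norm_eq_abs, abs_of_pos h2u]
    ring
  -- change of variables `w = (2u) • y`
  have hcv : ∫⁻ w : ℝ × ℝ, ENNReal.ofReal ((4 * u ^ 2 + ‖w‖ ^ 2) ^ (-(10 - η) / 2)) = ENNReal.ofReal ((2 * u) ^ 2) *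
      ∫⁻ y : ℝ × ℝ, ENNReal.ofReal ((4 * u ^ 2 + ‖(2 * u) • y‖ ^ 2) ^ (-(10 - η) / 2)) := by
    have e1 : ∫⁻ w : ℝ × ℝ, ENNReal.ofReal ((4 * u ^ 2 + ‖w‖ ^ 2) ^ (-(10 - η) / 2)) = ∫⁻ w,
        (fun y : ℝ × ℝ => ENNReal.ofReal ((4 * u ^ 2 + ‖(2 * u) • y‖ ^ 2) ^ (-(10 - η) / 2))) ((2 * u)⁻¹ • w) :=
      lintegral_congr fun w => by simp only [smul_inv_smul₀ h2u.ne']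
    rw [e1, ← lintegral_map hρ'm (measurable_const_smul _),
      Measure.map_addHaar_smul volume (inv_ne_zero h2u.ne'), lintegral_smul_measure]
    congr 2
    simp only [Module.finrank_prod, Module.finrank_self, Nat.reduceAdd, inv_pow, inv_inv]
    exact abs_of_pos (by positivity)
  have hm1 : Measurable fun w : ℝ × ℝ => ENNReal.ofReal ((1 + ‖w‖ ^ 2) ^ (-(10 - η) / 2)) :=
    ENNReal.measurable_ofReal.comp (continuous_bracket_rpow 1 _ one_pos).measurable
  rw [hcv, lintegral_congr hρ'eq, lintegral_const_mul _ hm1, ← mul_assoc, ← ENNReal.ofReal_mul (by positivity)]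
  gcongr
  -- `(2u)² (4u²)^s = (2u)^(η-8) ≤ u^(η-8)`
  have e2 : (2 * u) ^ 2 * (4 * u ^ 2) ^ (-(10 - η) / 2) = (2 * u) ^ (η - 8) := by
    rw [show (4 : ℝ) * u ^ 2 = (2 * u) ^ 2 by ring, ← Real.rpow_natCast (2 * u) 2, ← Real.rpow_mul h2u.le,
      ← Real.rpow_add h2u]
    congr 1
    push_cast; ring
  rw [e2, Real.mul_rpow (by norm_num) hu.le]
  exact mul_le_of_le_one_left (Real.rpow_nonneg hu.le _)
    (Real.rpow_le_one_of_one_le_of_nonpos (by norm_num) (by linarith))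

/-! ### The kernel off the diagonal and the double integral -/

/-- **Pointwise kernel bound off the diagonal**: if `|K x| ≤ C (1 + |x|^{η-10})` off `0`, `η ≤ 2`, then for `x₀⁰ ≤ -u < 0 < u ≤ x₁⁰`
(`2u`-separation in time) `|K(x₀ - x₁)| ≤ C⁺ (1 + (4u² + |x₀⊥ - x₁⊥|²)^{-(10-η)/2})`, `x⊥ = (x², x³)`, `C⁺ = max C 0`. [folklore] -/
theorem kernel_pointwise {K : E4 → ℝ} {C η u : ℝ} (hη2 : η ≤ 2) (hu : 0 < u)
    (hK : ∀ x : E4, x ≠ 0 → |K x| ≤ C * (1 + ‖x‖ ^ (η - 10)))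
    {x0 x1 : E4} (h0 : u ≤ -x0 0) (h1 : u ≤ x1 0) :
    |K (x0 - x1)| ≤ max C 0 * (1 + (4 * u ^ 2 + ‖((x0 2, x0 3) : ℝ × ℝ) - (x1 2, x1 3)‖ ^ 2) ^ (-(10 - η) / 2)) := by
  have hd0 : (x0 - x1) 0 ≤ -(2 * u) := by rw [PiLp.sub_apply]; linarith
  have hne : x0 - x1 ≠ 0 := fun h => by
    have : (x0 - x1) 0 = 0 := by rw [h]; rfl
    linarith
  have hsq : 4 * u ^ 2 + ‖((x0 2, x0 3) : ℝ × ℝ) - (x1 2, x1 3)‖ ^ 2 ≤ ‖x0 - x1‖ ^ 2 := by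
    rw [EuclideanSpace.norm_sq_eq, Fin.sum_univ_four]
    simp only [Real.norm_eq_abs, sq_abs, PiLp.sub_apply, Prod.mk_sub_mk, Prod.norm_mk]
    have h0sq : 4 * u ^ 2 ≤ (x0 0 - x1 0) ^ 2 := by rw [PiLp.sub_apply] at hd0; nlinarith
    have hmax : max |x0 2 - x1 2| |x0 3 - x1 3| ^ 2 ≤ (x0 2 - x1 2) ^ 2 + (x0 3 - x1 3) ^ 2 := by
      rcases le_total |x0 2 - x1 2| |x0 3 - x1 3| with h | h
      · rw [max_eq_right h, sq_abs]; nlinarith [sq_nonneg (x0 2 - x1 2)]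
      · rw [max_eq_left h, sq_abs]; nlinarith [sq_nonneg (x0 3 - x1 3)]
    nlinarith [sq_nonneg (x0 1 - x1 1)]
  have hpos : 0 < 4 * u ^ 2 + ‖((x0 2, x0 3) : ℝ × ℝ) - (x1 2, x1 3)‖ ^ 2 := by positivity
  have hrpow : ‖x0 - x1‖ ^ (η - 10) ≤ (4 * u ^ 2 + ‖((x0 2, x0 3) : ℝ × ℝ) - (x1 2, x1 3)‖ ^ 2) ^ (-(10 - η) / 2) := by
    rw [show η - 10 = 2 * (-(10 - η) / 2) by ring, Real.rpow_mul (norm_nonneg _), Real.rpow_two]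
    exact Real.rpow_le_rpow_of_nonpos hpos hsq (by linarith)
  calc |K (x0 - x1)| ≤ C * (1 + ‖x0 - x1‖ ^ (η - 10)) := hK _ hne
    _ ≤ max C 0 * (1 + ‖x0 - x1‖ ^ (η - 10)) :=
        mul_le_mul_of_nonneg_right (le_max_left _ _) (by positivity)
    _ ≤ max C 0 * (1 + (4 * u ^ 2 + ‖((x0 2, x0 3) : ℝ × ℝ) - (x1 2, x1 3)‖ ^ 2) ^ (-(10 - η) / 2)) := by gcongr

/-- **The double-integral bound.**  For `K` with `|K x| ≤ C (1 + |x|^{η-10})` off `0`, `η ≤ 2`, `u > 0`, a continuous insertion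
`ψ(x) = g(x⁰,x¹) hh(x²,x³)` with `g ≠ 0 ⇒ x⁰ ∈ [u, 2u]`, `g, hh` integrable, `∫|g| ≤ Mg`, `∫|hh| ≤ Mh`, `|hh| ≤ Mh'`, and any real
`L ≥ ∫_{ℝ²} (1 + |w|²)^{-(10-η)/2} dw`:
`∫∫ |K(x₀ - x₁)| |ψ(θ x₀)| |ψ(x₁)| dx₀ dx₁ ≤ C⁺ · (Mg Mh) · (Mg (Mh + u^{η-8} L Mh'))`, `θ` the time reflection. [folklore] -/
theorem double_lintegral_bound {K : E4 → ℝ} {C η u Mg Mh Mh' L : ℝ} {g hh : ℝ × ℝ → ℂ} {ψ : E4 → ℂ}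
    (hη2 : η ≤ 2) (hu : 0 < u)
    (hK : ∀ x : E4, x ≠ 0 → |K x| ≤ C * (1 + ‖x‖ ^ (η - 10)))
    (hψc : Continuous ψ) (hψ : ∀ q : E4, ψ q = g (q 0, q 1) * hh (q 2, q 3))
    (hgu : ∀ p : ℝ × ℝ, g p ≠ 0 → u ≤ p.1 ∧ p.1 ≤ 2 * u)
    (hgi : Integrable g) (hgM : (∫ p, ‖g p‖) ≤ Mg)
    (hhi : Integrable hh) (hhM : (∫ p, ‖hh p‖) ≤ Mh) (hhM' : ∀ p, ‖hh p‖ ≤ Mh')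
    (hL0 : 0 ≤ L) (hL : ∫⁻ w : ℝ × ℝ, ENNReal.ofReal ((1 + ‖w‖ ^ 2) ^ (-(10 - η) / 2)) ≤ ENNReal.ofReal L) :
    ∫⁻ z : E4 × E4, ‖K (z.1 - z.2)‖ₑ * ‖ψ (timeReflection 4 z.1)‖ₑ * ‖ψ z.2‖ₑ ≤
      ENNReal.ofReal (max C 0 * (Mg * Mh) * (Mg * (Mh + u ^ (η - 8) * L * Mh'))) := by
  have hMg : 0 ≤ Mg := (integral_nonneg fun _ => norm_nonneg _).trans hgM
  have hMh : 0 ≤ Mh := (integral_nonneg fun _ => norm_nonneg _).trans hhM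
  have hMh' : 0 ≤ Mh' := (norm_nonneg _).trans (hhM' 0)
  have hC : 0 ≤ max C 0 := le_max_right _ _
  -- the transverse weight `wt w = (4u² + |w|²)^{-(10-η)/2}` and the transverse coordinates `T x = (x², x³)`
  obtain ⟨wt, hwt⟩ : ∃ wt : ℝ × ℝ → ℝ≥0∞, wt = fun w => ENNReal.ofReal ((4 * u ^ 2 + ‖w‖ ^ 2) ^ (-(10 - η) / 2)) :=
    ⟨_, rfl⟩
  obtain ⟨T, hT⟩ : ∃ T : E4 → ℝ × ℝ, T = fun q => (q 2, q 3) := ⟨_, rfl⟩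
  have hwc : Continuous wt := hwt ▸ ENNReal.continuous_ofReal.comp (continuous_bracket_rpow _ _ (by positivity))
  have hTc : Continuous T := hT ▸ continuous_transverse
  have hwt_comm : ∀ p q : ℝ × ℝ, wt (p - q) = wt (q - p) := fun p q => by simp only [hwt, norm_sub_rev]
  -- enorm bookkeeping
  have hge : ∫⁻ p, ‖g p‖ₑ ≤ ENNReal.ofReal Mg := by
    rw [← ofReal_integral_norm_eq_lintegral_enorm hgi]; exact ENNReal.ofReal_le_ofReal hgM
  have hhe : ∫⁻ p, ‖hh p‖ₑ ≤ ENNReal.ofReal Mh := by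
    rw [← ofReal_integral_norm_eq_lintegral_enorm hhi]; exact ENNReal.ofReal_le_ofReal hhM
  have hhe' : ∀ p, ‖hh p‖ₑ ≤ ENNReal.ofReal Mh' := fun p => by
    rw [← ofReal_norm]; exact ENNReal.ofReal_le_ofReal (hhM' p)
  have hψe : ∀ q : E4, ‖ψ q‖ₑ = ‖g (q 0, q 1)‖ₑ * ‖hh (q 2, q 3)‖ₑ := fun q => by rw [hψ, enorm_mul]
  have hψm : Measurable fun q : E4 => ‖ψ q‖ₑ := hψc.measurable.enorm
  have hψθm : Measurable fun q : E4 => ‖ψ (timeReflection 4 q)‖ₑ :=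
    (hψc.comp (timeReflection 4).continuous).measurable.enorm
  -- `∫ |ψ| ≤ Mg Mh`
  have hψint : ∫⁻ q, ‖ψ q‖ₑ ≤ ENNReal.ofReal Mg * ENNReal.ofReal Mh := by
    rw [lintegral_congr hψe, lintegral_planar_mul_transverse (fun p => ‖g p‖ₑ) (fun p => ‖hh p‖ₑ)
      hgi.1.enorm hhi.1.enorm]
    exact mul_le_mul' hge hhe
  -- supports: `ψ x ≠ 0 ⇒ u ≤ x⁰`
  have hsuppψ : ∀ q : E4, ψ q ≠ 0 → u ≤ q 0 := fun q hq => by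
    rw [hψ] at hq; exact (hgu _ (left_ne_zero_of_mul hq)).1
  -- the pointwise bound by the majorant `C⁺ |ψ(θx₀)| (1 + wt(x₀⊥ - x₁⊥)) |ψ(x₁)|`
  have hpt : ∀ z : E4 × E4, ‖K (z.1 - z.2)‖ₑ * ‖ψ (timeReflection 4 z.1)‖ₑ * ‖ψ z.2‖ₑ ≤
      ENNReal.ofReal (max C 0) * (‖ψ (timeReflection 4 z.1)‖ₑ * ((1 + wt (T z.1 - T z.2)) * ‖ψ z.2‖ₑ)) := by
    intro z
    by_cases h1 : ψ (timeReflection 4 z.1) = 0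
    · simp [h1]
    by_cases h2 : ψ z.2 = 0
    · simp [h2]
    have hu0 : u ≤ -z.1 0 := by
      have := hsuppψ _ h1; rwa [OSReconstructionNoE1.timeReflection_apply_zero] at this
    have hk : ‖K (z.1 - z.2)‖ₑ ≤ ENNReal.ofReal (max C 0) * (1 + wt (T z.1 - T z.2)) := by
      rw [Real.enorm_eq_ofReal_abs]
      refine (ENNReal.ofReal_le_ofReal (kernel_pointwise hη2 hu hK hu0 (hsuppψ _ h2))).trans (le_of_eq ?_)
      rw [ENNReal.ofReal_mul hC, ENNReal.ofReal_add zero_le_one (Real.rpow_nonneg (by positivity) _),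
        ENNReal.ofReal_one, hwt, hT]
    calc ‖K (z.1 - z.2)‖ₑ * ‖ψ (timeReflection 4 z.1)‖ₑ * ‖ψ z.2‖ₑ
        ≤ ENNReal.ofReal (max C 0) * (1 + wt (T z.1 - T z.2)) * ‖ψ (timeReflection 4 z.1)‖ₑ * ‖ψ z.2‖ₑ := by gcongr
      _ = _ := by ring
  -- measurability of the majorant
  have hGm : Measurable fun z : E4 × E4 =>
      ‖ψ (timeReflection 4 z.1)‖ₑ * ((1 + wt (T z.1 - T z.2)) * ‖ψ z.2‖ₑ) :=
    (hψθm.comp measurable_fst).mul ((((hwc.comp ((hTc.comp continuous_fst).sub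
      (hTc.comp continuous_snd))).measurable).const_add 1).mul (hψm.comp measurable_snd))
  have hGm1 : ∀ x0 : E4, Measurable fun x1 : E4 => (1 + wt (T x0 - T x1)) * ‖ψ x1‖ₑ :=
    fun x0 => ((hwc.measurable.comp (hTc.measurable.const_sub _)).const_add 1).mul hψm
  -- the inner (`x₁`) integral, uniformly in `x₀`
  have hinner : ∀ x0 : E4, ∫⁻ x1, (1 + wt (T x0 - T x1)) * ‖ψ x1‖ₑ ≤
      ENNReal.ofReal Mg * (ENNReal.ofReal Mh + ENNReal.ofReal (u ^ (η - 8)) * ENNReal.ofReal L * ENNReal.ofReal Mh') := by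
    intro x0
    have hwq : Measurable fun q : ℝ × ℝ => wt (T x0 - q) := hwc.measurable.comp (measurable_id.const_sub _)
    have e1 : ∫⁻ x1, (1 + wt (T x0 - T x1)) * ‖ψ x1‖ₑ =
        ∫⁻ x1 : E4, ‖g (x1 0, x1 1)‖ₑ * ((1 + wt (T x0 - (x1 2, x1 3))) * ‖hh (x1 2, x1 3)‖ₑ) :=
      lintegral_congr fun x1 => by rw [hψe, hT]; ring
    rw [e1, lintegral_planar_mul_transverse (fun p => ‖g p‖ₑ) (fun q => (1 + wt (T x0 - q)) * ‖hh q‖ₑ)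
      hgi.1.enorm ((hwq.const_add 1).aemeasurable.mul hhi.1.enorm)]
    refine mul_le_mul' hge ?_
    calc ∫⁻ q, (1 + wt (T x0 - q)) * ‖hh q‖ₑ
        = ∫⁻ q, (‖hh q‖ₑ + wt (T x0 - q) * ‖hh q‖ₑ) := lintegral_congr fun q => by ring
      _ = (∫⁻ q, ‖hh q‖ₑ) + ∫⁻ q, wt (T x0 - q) * ‖hh q‖ₑ := lintegral_add_right' _ (hwq.aemeasurable.mul hhi.1.enorm)
      _ ≤ ENNReal.ofReal Mh + ∫⁻ q, wt (T x0 - q) * ENNReal.ofReal Mh' :=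
          add_le_add hhe (lintegral_mono fun q => mul_le_mul' le_rfl (hhe' q))
      _ = ENNReal.ofReal Mh + (∫⁻ q, wt (q - T x0)) * ENNReal.ofReal Mh' := by
          rw [lintegral_mul_const _ hwq]
          simp_rw [hwt_comm (T x0)]
      _ = ENNReal.ofReal Mh + (∫⁻ q, wt q) * ENNReal.ofReal Mh' := by rw [lintegral_sub_right_eq_self wt (T x0)]
      _ ≤ ENNReal.ofReal Mh + ENNReal.ofReal (u ^ (η - 8)) * ENNReal.ofReal L * ENNReal.ofReal Mh' := by
          gcongr
          rw [hwt]
          exact (lintegral_transverse_weight_le η u hη2 hu).trans (mul_le_mul' le_rfl hL)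
  -- assemble: Tonelli, the inner bound, `θ`-invariance of Lebesgue measure, `∫|ψ| ≤ Mg Mh`
  calc ∫⁻ z : E4 × E4, ‖K (z.1 - z.2)‖ₑ * ‖ψ (timeReflection 4 z.1)‖ₑ * ‖ψ z.2‖ₑ
      ≤ ∫⁻ z : E4 × E4, ENNReal.ofReal (max C 0) *
          (‖ψ (timeReflection 4 z.1)‖ₑ * ((1 + wt (T z.1 - T z.2)) * ‖ψ z.2‖ₑ)) := lintegral_mono hpt
    _ = ENNReal.ofReal (max C 0) * ∫⁻ x0 : E4, ∫⁻ x1 : E4,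
          ‖ψ (timeReflection 4 x0)‖ₑ * ((1 + wt (T x0 - T x1)) * ‖ψ x1‖ₑ) := by
        rw [lintegral_const_mul _ hGm]
        exact congrArg _ (lintegral_prod _ hGm.aemeasurable)
    _ = ENNReal.ofReal (max C 0) * ∫⁻ x0 : E4,
          ‖ψ (timeReflection 4 x0)‖ₑ * ∫⁻ x1 : E4, (1 + wt (T x0 - T x1)) * ‖ψ x1‖ₑ :=
        congrArg _ (lintegral_congr fun x0 => lintegral_const_mul _ (hGm1 x0))
    _ ≤ ENNReal.ofReal (max C 0) * ∫⁻ x0 : E4, ‖ψ (timeReflection 4 x0)‖ₑ * (ENNReal.ofReal Mg *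
          (ENNReal.ofReal Mh + ENNReal.ofReal (u ^ (η - 8)) * ENNReal.ofReal L * ENNReal.ofReal Mh')) := by
        gcongr with x0
        exact hinner x0
    _ = ENNReal.ofReal (max C 0) * ((∫⁻ x0 : E4, ‖ψ x0‖ₑ) * (ENNReal.ofReal Mg *
          (ENNReal.ofReal Mh + ENNReal.ofReal (u ^ (η - 8)) * ENNReal.ofReal L * ENNReal.ofReal Mh'))) := by
        rw [lintegral_mul_const _ hψθm, (timeReflection 4).measurePreserving.lintegral_comp hψm]
    _ ≤ ENNReal.ofReal (max C 0) * ((ENNReal.ofReal Mg * ENNReal.ofReal Mh) * (ENNReal.ofReal Mg *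
          (ENNReal.ofReal Mh + ENNReal.ofReal (u ^ (η - 8)) * ENNReal.ofReal L * ENNReal.ofReal Mh'))) := by
        gcongr
    _ = ENNReal.ofReal (max C 0 * (Mg * Mh) * (Mg * (Mh + u ^ (η - 8) * L * Mh'))) := by
        have hu8 : 0 ≤ u ^ (η - 8) := Real.rpow_nonneg hu.le _
        rw [ENNReal.ofReal_mul (by positivity), ENNReal.ofReal_mul hC, ENNReal.ofReal_mul hMg,
          ENNReal.ofReal_mul hMg, ENNReal.ofReal_add hMh (by positivity), ENNReal.ofReal_mul (by positivity),
          ENNReal.ofReal_mul hu8]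
        ring

/-- **The double-integral bound, closed form** (the registered helper stub `vacuumRow_double_lintegral_bound` of crux
stmt-QuantumFields-11686, line `complex-rotation-bandlimit`, generation 12 — the analytic core of `stub_sandwichVacuumRowOfKernel`,
restated with all binders explicit so that this helper file lands against a registered signature): for `K` with
`|K x| ≤ C (1 + |x|^{η-10})` off `0`, `η ≤ 2`, `u > 0`, a continuous insertion `ψ(x) = g(x⁰,x¹) hh(x²,x³)` with `g ≠ 0 ⇒ x⁰ ∈ [u, 2u]`,
`g, hh` integrable, `∫|g| ≤ Mg`, `∫|hh| ≤ Mh`, `|hh| ≤ Mh'`, and any real `L ≥ ∫_{ℝ²} (1 + |w|²)^{-(10-η)/2} dw`: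
`∫∫ |K(x₀ - x₁)| |ψ(θ x₀)| |ψ(x₁)| dx₀ dx₁ ≤ C⁺ · (Mg Mh) · (Mg (Mh + u^{η-8} L Mh'))`. [folklore] -/
theorem vacuumRow_double_lintegral_bound :
    open Literature.MathematicalPhysics.QuantumLattice Literature.MathematicalPhysics.QuantumFieldTheory
      Summit.QuantumFields.YangMills.Theorems.NPointIsotropy.Negative MeasureTheory in
    ∀ (K : E4 → ℝ) (C η u Mg Mh Mh' L : ℝ) (g hh : ℝ × ℝ → ℂ) (ψ : E4 → ℂ), η ≤ 2 → 0 < u →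
      (∀ x : E4, x ≠ 0 → |K x| ≤ C * (1 + ‖x‖ ^ (η - 10))) →
      Continuous ψ → (∀ q : E4, ψ q = g (q 0, q 1) * hh (q 2, q 3)) →
      (∀ p : ℝ × ℝ, g p ≠ 0 → u ≤ p.1 ∧ p.1 ≤ 2 * u) →
      MeasureTheory.Integrable g → (∫ p, ‖g p‖) ≤ Mg →
      MeasureTheory.Integrable hh → (∫ p, ‖hh p‖) ≤ Mh → (∀ p, ‖hh p‖ ≤ Mh') →
      0 ≤ L → (∫⁻ w : ℝ × ℝ, ENNReal.ofReal ((1 + ‖w‖ ^ 2) ^ (-(10 - η) / 2)) ≤ ENNReal.ofReal L) →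
      ∫⁻ z : E4 × E4, ‖K (z.1 - z.2)‖ₑ * ‖ψ (timeReflection 4 z.1)‖ₑ * ‖ψ z.2‖ₑ ≤
        ENNReal.ofReal (max C 0 * (Mg * Mh) * (Mg * (Mh + u ^ (η - 8) * L * Mh'))) := by
  intro K C η u Mg Mh Mh' L g hh ψ hη2 hu hK hψc hψ hgu hgi hgM hhi hhM hhM' hL0 hL
  exact double_lintegral_bound hη2 hu hK hψc hψ hgu hgi hgM hhi hhM hhM' hL0 hL

end Summit.QuantumFields.YangMills.Theorems.NPointIsotropy.ComplexRotationBandlimit.SandwichVacuumRow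

end
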